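import Literature.Geometry.Kaehler.ComplexTorusEquivariantEndomorphismAlgebraCommutantCyclicFixedPoints
import HarnessLib

/-!
# Powers of an endomorphism of finite order: `D(u^k) = {d/(d,k) : d ∈ D}`, `ord u = lcm D`, Galois-conjugate
# powers share `q_u`, `P^r_u` and `#Fix`, and `δ^k` has infinitely many fixed points iff some `d ∈ D` divides `k`
# (the fixed-point function of an automorphism of finite order is periodic with zeros on `⋃_{d ∈ D} dℕ`)

Layer `Literature/Geometry/Kaehler`, namespace `Literature.Geometry.Kaehler.ComplexTorus` (§1 in
`Literature.Geometry.Kaehler.CyclotomicIdempotents`, generation 7's namespace for the cyclotomic `ℚ`-algebra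
lemmas); lane `lit-hodgefound` (Track 2 foundations library), Layer A2, row «A2-26(fa)» (self-proposed 2026-08-28,
prover seat `lit-hodgefound-p10`, generation 28, FILE 2).  Generation 27 FILE 2 (`…CommutantCyclicCyclotomic`)
proved, for `u ∈ End_ℚ(X)` with `uⁿ = 1` and `D = eigenvalueOrders n u` (generation 9: the `d ∣ n` whose cyclotomic
idempotent `e_d(u)` is non-zero): `d ∈ D ⟺ Φ_d ∣ q_u ⟺ Φ_d ∣ P^r_u` and `q_u = Π_{d ∈ D} Φ_d`; FILE 5
(`…CommutantCyclicFixedPoints`) read `#X^δ = |P^r_δ(1)|` off `D` in the squarefree case.  THIS FILE follows the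
whole cyclic group `⟨u⟩`: the eigenvalues of `u^k` are the `k`-th powers `ζ^k` of those of `u`, and `ζ^k` is a
primitive `d/(d,k)`-th root of unity for `ζ` a primitive `d`-th root — in the tree's eigenvalue-free language,
`Φ_d(x) ∣ Φ_{d/(d,k)}(x^k)` and conversely `Φ_d ∣ r(x^k) ⟹ Φ_{d/(d,k)} ∣ r` (§1, through one primitive root in `ℂ`
and `Φ_m = minpoly_ℚ(ζ_m)`).  Hence `q_{u^k} = Π_{m ∈ D_k} Φ_m` with `D_k = {d/(d,k) : d ∈ D} = D(u^k)`, the order of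
`u` is `lcm D` («`1 ≤ d_1 < ⋯ < d_s`, `d_i | n` the orders of the eigenvalues»), powers `u^k` with `(k, n) = 1` have the
same `D`, `q`, `ℚ[u^k] = ℚ[u]` and — for squarefree `P^r_u` — the same `P^r` and the same number of fixed points,
and, for an automorphism `δ` with `ρ_r(δ) ⊗ 1 = u`: `#X^{δ^k} = |det(1 − ρ_r(δ)^k)|` vanishes (i.e. `X^{δ^k}` is
infinite) iff `1 ∈ D(u^k)` iff SOME `d ∈ D` DIVIDES `k` — Alvarado–Auffarth's periodic fixed-point function with
zeros exactly on the multiples of the `n_i`, here identified: `{n_i} = D`.  CONSUMED BY NAME, nothing restated: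
generation 9's `eigenvalueOrders`, FILE 2's `mem_eigenvalueOrders_iff_cyclotomic_dvd_minpoly` /
`mem_eigenvalueOrders_iff_cyclotomic_dvd_charpoly` / `minpoly_coe_eq_prod_cyclotomic_eigenvalueOrders` /
`pairwise_isCoprime_cyclotomic` / `eq_prod_cyclotomic_of_dvd_X_pow_sub_one` / `minpoly_dvd_X_pow_sub_one` /
`sum_totient_eigenvalueOrders_le_card` / `natDegree_minpoly_coe_eq_sum_totient`, FILE 1's
`matrix_minpoly_eq_charpoly_of_squarefree_charpoly`, FILE 5's `intCast_det_one_sub_eq_eval_one` /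
`natCard_fixedSubgroup_eq_eval_one` / `eigenvalueOrders_gaussEnd` / `natCard_fixedSubgroup_rotI` /
`eigenvalueOrders_surfaceAut` / `natCard_fixedSubgroup_surfaceAutMatrix`, seat p11's `fixedSubgroup` /
`natCard_fixedSubgroup` / `natCard_fixedSubgroup_eq_pow`, seat p38's `rotI` / `surfaceAutMatrix` / `surfacePeriod` /
`orderOf_surfaceAutMatrix`, FILE 3's `gaussEnd_pow_four` / `gaussOmegaEnd_pow_twelve` / `squarefree_charpoly_gaussJ` /
`squarefree_charpoly_gaussOmega`, and Mathlib's `orderOf_pow'` / `cyclotomic_eq_minpoly_rat` /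
`cyclotomic_eq_prod_X_sub_primitiveRoots` / `Finset.prod_dvd_of_coprime` / `exists_pow_eq_self_of_coprime`.
Theorems only; NO definition, NO named fact (D-0026, net debt 0).

## The print

* M. Alvarado, R. Auffarth, *Fixed points of endomorphisms of complex tori*, J. Algebra 507 (2018) 428–438 (held
  `paper:arxiv-1705.09681`), Thm. 1.1 (p0003), VERBATIM: «Let `X` be a complex torus of dimension `g` and let `f`
  be an endomorphism of `X`. Then `#Fix(fⁿ)` has one of the following behaviors: • It grows exponentially in `n`
  […] • It is a periodic function, and the non-zero eigenvalues of `f` are `k`-th roots of unity where `k` is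
  contained in the set `{n ∈ ℕ : φ(n) ≤ 2g}` […] • There exist integers `n_1, …, n_r ≥ 2` […] such that
  `#Fix(fⁿ) = 0` if `n ≡ 0 (mod n_i)` for some `i`, `h(n)` otherwise»; Remark 2.4 (p0004): «if `f` is an
  automorphism of finite order, then its eigenvalues are roots of unity […] if `λ` is an eigenvalue of order `k` of
  `f`, `φ(k) ≤ 2g`»; §3 (p0006): «`F(n) = Δ_n(χ^r_f)`», `Δ_n(Q) := Π_i (α_iⁿ − 1)`.  (Their `#Fix := 0` for an
  infinite fixed-point set is the tree's `Nat.card = 0`.)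
* A. Carocca, H. Lange, R. E. Rodríguez, *Abelian varieties with finite abelian group action*, Arch. Math. 112
  (2019), §2.2 (p0004): «`1 ≤ d_1 < d_2 < ⋯ < d_s`, `d_i | n` denote the orders of the eigenvalues of `α`».
* I. Dolgachev, Yu. G. Zarhin, *Endomorphisms of Complex Abelian Varieties* (2024; held
  `paper:galaxy-pdf-8712177384607648460`), §2.2 (2.15)–(2.17) (p0033–p0034): «`A^δ ≅ Λ/(1 − δ)Λ`», «`1` is not an
  eigenvalue».
* H. Lange, R. E. Rodríguez, *Decomposition of Jacobians by Prym Varieties*, LNM 2310 (2022), §6.1.1 (p0152–p0153):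
  the irreducible rational representations `W_d`, `d ∣ n`, of `⟨σ⟩` (`ρ_r = Σ_d h_d W_d`; `σ^k` acts on `W_d`
  through the primitive `d/(d,k)`-th roots of unity).
* J. Kuzmanovich, A. Pavlichenkov, *Finite groups of matrices whose entries are integers*, Amer. Math. Monthly 109
  (2002), Thm. 2.7 (cited by seat p38's `ComplexTorusAutomorphismOrder` through Bamberg–Cairns–Kilminster 2003):
  the order of a matrix of finite order is the least common multiple of the orders of its eigenvalues.
* H. Lange, Ch. Birkenhake, *Complex Abelian Varieties* (1992), Ch. 13 §1 (holomorphic Lefschetz fixed-point formula).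

## What is proved (`X = E/Φ(ℤ^ι)`, `u ∈ End_ℚ(X) = endAlgRat Φ ⊆ M_ι(ℚ)`, `uⁿ = 1`, `n > 0`, `D = eigenvalueOrders n u`,
`q_v = minpoly ℚ (v : M_ι(ℚ))`, `P^r_v = charpoly`, `k > 0`, `D_k := D.image (d ↦ d/(d,k))`)

* §1 CYCLOTOMIC POLYNOMIALS UNDER `x ↦ x^k` (`ℚ[x]`, and any `ℚ`-algebra `A ∋ u`, `uⁿ = 1`):
  **`cyclotomic_dvd_expand_cyclotomic_div_gcd`** (`Φ_d ∣ Φ_{d/(d,k)}(x^k)`),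
  **`cyclotomic_div_gcd_dvd_of_cyclotomic_dvd_expand`** (`Φ_d ∣ r(x^k) ⟹ Φ_{d/(d,k)} ∣ r`),
  **`cyclotomic_dvd_minpoly_pow_iff`** (`Φ_m ∣ q_{u^k} ⟺ ∃ d ∣ n, Φ_d ∣ q_u ∧ m = d/(d,k)`),
  **`minpoly_pow_eq_prod_cyclotomic`** (`q_{u^k} = Π_{m ∈ D_k} Φ_m`).
* §2 TORUS LEVEL: **`eigenvalueOrders_pow`** (`D(u^k) = D_k`), `minpoly_coe_pow_eq_prod_cyclotomic`,
  `natDegree_minpoly_coe_pow` / `finrank_adjoin_coe_pow` (`dim ℚ[u^k] = Σ_{m ∈ D_k} φ(m)`),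
  `totient_le_card_of_mem_eigenvalueOrders` (Remark 2.4: `φ(d) ≤ 2 dim X` for `d ∈ D`); COPRIME POWERS
  (`(k, n) = 1`): **`eigenvalueOrders_pow_of_coprime`** (`D(u^k) = D`), `minpoly_coe_pow_of_coprime` (`q_{u^k} = q_u`),
  `adjoin_coe_pow_eq_of_coprime` (`ℚ[u^k] = ℚ[u]`), **`charpoly_coe_pow_of_coprime`** (`P^r_u` squarefree ⟹
  `P^r_{u^k} = P^r_u`), `squarefree_charpoly_coe_pow_of_coprime`; THE ORDER: **`pow_eq_one_iff_forall_dvd`**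
  (`u^k = 1 ⟺ ∀ d ∈ D, d ∣ k`), **`orderOf_eq_lcm_eigenvalueOrders`** (`ord u = lcm D`), `orderOf_dvd_iff_forall_dvd`,
  `one_mem_eigenvalueOrders_pow_iff` (`1 ∈ D(u^k) ⟺ ∃ d ∈ D, d ∣ k`).
* §3 FIXED POINTS OF THE POWERS of an automorphism `δ` (`u = ρ_r(δ) ⊗ 1 = D_ℚ`, `X^{δ^k} = fixedSubgroup Φ (D^k)`):
  `coe_pow_eq_map_pow`, `pow_eq_one_of_coe_eq_map` (`Dⁿ = 1`), **`natCard_fixedSubgroup_pow_eq_zero_iff`**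
  (`#X^{δ^k} = 0`, i.e. `X^{δ^k}` infinite, `⟺ ∃ d ∈ D, d ∣ k` — type (3)/(2) of Thm. 1.1 with `{n_i} = D`),
  `natCard_fixedSubgroup_pow_pos_iff`, `finite_fixedSubgroup_pow_iff`, `natCard_fixedSubgroup_pow_pos_of_forall_lt`
  (`0 < k < min D`), **`fixedSubgroup_pow_add`** / **`natCard_fixedSubgroup_pow_eq_mod`** (the fixed-point function
  `k ↦ #X^{δ^k}` is periodic of period `n`), `natCard_fixedSubgroup_pow_orderOf` (`= 0`),
  **`natCard_fixedSubgroup_pow_of_coprime`** (`P^r_u` squarefree, `(k, n) = 1 ⟹ #X^{δ^k} = #X^δ`).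
* §4 INSTANCES: `E_i`, `δ = i` (`D = {4}`): **`natCard_fixedSubgroup_rotI_pow_eq_zero_iff`** (`⟺ 4 ∣ k`),
  `natCard_fixedSubgroup_rotI_pow_of_odd` (`= 2`), `natCard_fixedSubgroup_rotI_sq` (`#Fix(−1) = #E_i[2] = 4`, the
  non-squarefree value through p11's one-factor formula) — the periodic fixed-point function `(2, 4, 2, 0, 2, 4, 2, 0, …)`;
  `E_i × E_ω`, `δ = (i, ω)` of order `12` (`D = {4, 3}`): **`natCard_fixedSubgroup_surfaceAutMatrix_pow_eq_zero_iff`**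
  (`⟺ 4 ∣ k ∨ 3 ∣ k`), `natCard_fixedSubgroup_surfaceAutMatrix_pow_of_coprime` (`= 6` for `(k, 12) = 1`),
  `lcm_eigenvalueOrders_surfaceAut` (`lcm D = 12 =` p38's `orderOf_surfaceAutMatrix`).

## References

* [AlvaradoAuffarth2018] M. Alvarado, R. Auffarth, *Fixed points of endomorphisms of complex tori*, J. Algebra 507
  (2018) 428–438, Thm. 1.1, Remark 2.4, §3 (arXiv PDF pp. 3, 4, 6).
* [CaroccaLangeRodriguez2019] A. Carocca, H. Lange, R. E. Rodríguez, Arch. Math. 112 (2019), §2.2.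
* [DolgachevZarhin2024] I. Dolgachev, Yu. G. Zarhin, *Endomorphisms of Complex Abelian Varieties* (2024), §2.2
  (2.15)–(2.17).
* [LangeRodriguez2022] H. Lange, R. E. Rodríguez, *Decomposition of Jacobians by Prym Varieties*, LNM 2310 (2022),
  §6.1.1 Prop. 6.1.2.
* [BambergCairnsKilminster2003] J. Bamberg, G. Cairns, D. Kilminster, Amer. Math. Monthly 110 (2003), Thm. 1 (after
  Kuzmanovich–Pavlichenkov 2002, Thm. 2.7).
* [LangeBirkenhake1992] H. Lange, Ch. Birkenhake, *Complex Abelian Varieties* (1992), Ch. 13 §1.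
* [BauerHerrig2016] T. Bauer, T. Herrig, *Fixed points of endomorphisms on two-dimensional complex tori*, J. Algebra
  458 (2016) 351–363, §1.
-/

noncomputable section

open Module Function Polynomial Finset
open scoped Matrix

namespace Literature.Geometry.Kaehler

/-! ### §1 Cyclotomic polynomials under `x ↦ x^k` -/

namespace CyclotomicIdempotents

section Expand

/-- For `ζ` of order `d`, `ζ^k` has order `d/(d,k)`: a primitive `d`-th root of unity raised to the `k`-th power
is a primitive `d/(d,k)`-th root of unity. [cite: LangeRodriguez2022, §6.1.1 (the Galois orbit of `ξ_d^k`), p0152] -/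
theorem isPrimitiveRoot_pow_div_gcd {M : Type*} [CommMonoid M] {ζ : M} {d : ℕ} (hζ : IsPrimitiveRoot ζ d) {k : ℕ}
    (hk : 0 < k) : IsPrimitiveRoot (ζ ^ k) (d / d.gcd k) := by
  have h := IsPrimitiveRoot.orderOf (ζ ^ k)
  rwa [orderOf_pow' ζ hk.ne', ← hζ.eq_orderOf] at h

/-- `d/(d,k) > 0` for `d > 0`. [folklore] -/
private theorem div_gcd_pos {d : ℕ} (hd : 0 < d) (k : ℕ) : 0 < d / d.gcd k :=
  Nat.div_pos (Nat.gcd_le_left _ hd) (Nat.gcd_pos_of_pos_left _ hd)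

/-- `d/(d,k) ∣ d`. [folklore] -/
private theorem div_gcd_dvd (d k : ℕ) : d / d.gcd k ∣ d :=
  Nat.div_dvd_of_dvd (Nat.gcd_dvd_left d k)

/-- `d/(d,k) = 1 ⟺ d ∣ k` (`d > 0`). [folklore] -/
private theorem div_gcd_eq_one_iff {d : ℕ} (hd : 0 < d) {k : ℕ} : d / d.gcd k = 1 ↔ d ∣ k := by
  constructor
  · intro h
    have := Nat.eq_of_dvd_of_div_eq_one (Nat.gcd_dvd_left d k) h
    rw [← this]
    exact Nat.gcd_dvd_right d k
  · intro h
    rw [Nat.gcd_eq_left h, Nat.div_self hd]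

/-- `aeval z Φ_d = Φ_d(z)` in `ℂ` for the rational cyclotomic polynomial. [folklore] -/
private theorem aeval_cyclotomic_complex (d : ℕ) (z : ℂ) : aeval z (cyclotomic d ℚ) = (cyclotomic d ℂ).eval z := by
  rw [← map_cyclotomic d (algebraMap ℚ ℂ), eval_map, aeval_def]

/-- **`Φ_d(x) ∣ Φ_{d/(d,k)}(x^k)`** in `ℚ[x]` (`d, k > 0`): every primitive `d`-th root of unity `ζ` is a root of
`Φ_{d/(d,k)}(x^k)`, and `Φ_d = Π (x − ζ)` is separable. [cite: LangeRodriguez2022, §6.1.1 (`W_d`, Galois orbits of `ξ_d^k`), p0152–p0153]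
[cite: AlvaradoAuffarth2018, Remark 2.4 («if `λ` is an eigenvalue of order `k`»), p0004] -/
theorem cyclotomic_dvd_expand_cyclotomic_div_gcd {d : ℕ} (hd : 0 < d) {k : ℕ} (hk : 0 < k) :
    cyclotomic d ℚ ∣ expand ℚ k (cyclotomic (d / d.gcd k) ℚ) := by
  have hm : 0 < d / d.gcd k := div_gcd_pos hd k
  haveI : NeZero ((d / d.gcd k : ℕ) : ℂ) := ⟨Nat.cast_ne_zero.2 hm.ne'⟩
  rw [← Polynomial.map_dvd_map (algebraMap ℚ ℂ) (algebraMap ℚ ℂ).injective (cyclotomic.monic d ℚ),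
    map_cyclotomic, map_expand, map_cyclotomic,
    cyclotomic_eq_prod_X_sub_primitiveRoots (Complex.isPrimitiveRoot_exp d hd.ne')]
  refine Finset.prod_dvd_of_coprime
    ((pairwise_coprime_X_sub_C (K := ℂ) (s := fun μ : ℂ ↦ μ) fun _ _ h ↦ h).set_pairwise _) fun μ hμ ↦ ?_
  rw [mem_primitiveRoots hd] at hμ
  rw [dvd_iff_isRoot, IsRoot.def, expand_eval, ← IsRoot.def, isRoot_cyclotomic_iff]
  exact isPrimitiveRoot_pow_div_gcd hμ hk

/-- **`Φ_d ∣ r(x^k) ⟹ Φ_{d/(d,k)} ∣ r`** for `r ∈ ℚ[x]` (`d, k > 0`): `r` vanishes at `ζ_d^k`, a primitive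
`d/(d,k)`-th root of unity, whose minimal polynomial over `ℚ` is `Φ_{d/(d,k)}`.
[cite: LangeRodriguez2022, §6.1.1 (`K_d = ℚ(ξ_d)`, `Φ_d` irreducible), p0152] -/
theorem cyclotomic_div_gcd_dvd_of_cyclotomic_dvd_expand {d : ℕ} (hd : 0 < d) {k : ℕ} (hk : 0 < k) {r : ℚ[X]}
    (h : cyclotomic d ℚ ∣ expand ℚ k r) : cyclotomic (d / d.gcd k) ℚ ∣ r := by
  set μ : ℂ := Complex.exp (2 * Real.pi * Complex.I / d) with hμdef
  have hμ : IsPrimitiveRoot μ d := Complex.isPrimitiveRoot_exp d hd.ne'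
  have hμk : IsPrimitiveRoot (μ ^ k) (d / d.gcd k) := isPrimitiveRoot_pow_div_gcd hμ hk
  rw [cyclotomic_eq_minpoly_rat hμk (div_gcd_pos hd k)]
  refine minpoly.dvd ℚ (μ ^ k) ?_
  obtain ⟨s, hs⟩ := h
  rw [← expand_aeval, hs, map_mul, aeval_cyclotomic_complex, (hμ.isRoot_cyclotomic hd).eq_zero, zero_mul]

end Expand

/-! #### `q_{u^k}` for `uⁿ = 1` in any `ℚ`-algebra -/

section Algebra

variable {A : Type*} [Ring A] [Algebra ℚ A] {n : ℕ} {u : A}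

/-- `u` with `uⁿ = 1` is integral over `ℚ`. [folklore] -/
private theorem isIntegral_of_pow_eq_one' (hn : 0 < n) (hu : u ^ n = 1) : IsIntegral ℚ u :=
  ⟨X ^ n - 1, monic_X_pow_sub_C 1 hn.ne', by simp [hu]⟩

omit [Algebra ℚ A] in
/-- `(u^k)ⁿ = 1`. [folklore] -/
private theorem pow_pow_eq_one (hu : u ^ n = 1) (k : ℕ) : (u ^ k) ^ n = 1 := by
  rw [← pow_mul, mul_comm, pow_mul, hu, one_pow]

/-- `q_u ∣ P(x^k)` whenever `P(u^k) = 0`; in particular `q_u ∣ q_{u^k}(x^k)`. [folklore] -/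
private theorem minpoly_dvd_expand_minpoly_pow (k : ℕ) : minpoly ℚ u ∣ expand ℚ k (minpoly ℚ (u ^ k)) :=
  minpoly.dvd ℚ u (by rw [expand_aeval, minpoly.aeval])

/-- **`Φ_m ∣ q_{u^k} ⟺ m = d/(d,k)` for some `d ∣ n` with `Φ_d ∣ q_u`** (`uⁿ = 1` in any `ℚ`-algebra,
`n, k, m > 0`): the cyclotomic factors of the minimal polynomial of `u^k` are exactly the `Φ_{d/(d,k)}`, `Φ_d` a
factor of `q_u` — the eigenvalues of `u^k` are the `k`-th powers of those of `u`.
[cite: AlvaradoAuffarth2018, §3 («`Δ_n(Q) := Π (α_iⁿ − 1)`», the eigenvalues of `fⁿ`), p0006] [cite: LangeRodriguez2022, §6.1.1 Prop. 6.1.2, p0153] -/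
theorem cyclotomic_dvd_minpoly_pow_iff (hn : 0 < n) (hu : u ^ n = 1) {k : ℕ} (hk : 0 < k) {m : ℕ} (hm : 0 < m) :
    cyclotomic m ℚ ∣ minpoly ℚ (u ^ k) ↔
      ∃ d ∈ n.divisors, cyclotomic d ℚ ∣ minpoly ℚ u ∧ d / d.gcd k = m := by
  classical
  constructor
  · intro h
    -- `q_{u^k} ∣ Q := Π_{m' ∈ D_k} Φ_{m'}`
    set Dset := n.divisors.filter (fun d ↦ cyclotomic d ℚ ∣ minpoly ℚ u) with hDset
    set Dk := Dset.image (fun d ↦ d / d.gcd k) with hDk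
    have hq : minpoly ℚ u = ∏ d ∈ Dset, cyclotomic d ℚ :=
      eq_prod_cyclotomic_of_dvd_X_pow_sub_one hn (minpoly.monic (isIntegral_of_pow_eq_one' hn hu))
        (minpoly_dvd_X_pow_sub_one hu)
    have hqQ : minpoly ℚ u ∣ expand ℚ k (∏ m' ∈ Dk, cyclotomic m' ℚ) := by
      rw [hq, map_prod]
      refine Finset.prod_dvd_of_coprime ((pairwise_isCoprime_cyclotomic Dset).mono' fun _ _ ↦ id) fun d hd ↦ ?_
      have hd0 : 0 < d := Nat.pos_of_mem_divisors (Finset.mem_filter.1 hd).1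
      exact (cyclotomic_dvd_expand_cyclotomic_div_gcd hd0 hk).trans
        (Finset.dvd_prod_of_mem _ (Finset.mem_image_of_mem _ hd))
    have hrQ : minpoly ℚ (u ^ k) ∣ ∏ m' ∈ Dk, cyclotomic m' ℚ :=
      minpoly.dvd ℚ (u ^ k) (by rw [← expand_aeval]; exact (minpoly.dvd_iff.1 hqQ))
    obtain ⟨m', hm', hmm'⟩ := ((cyclotomic.irreducible_rat hm).prime.dvd_finsetProd_iff _).1 (h.trans hrQ)
    obtain ⟨d, hd, rfl⟩ := Finset.mem_image.1 hm'
    have hd0 : 0 < d := Nat.pos_of_mem_divisors (Finset.mem_filter.1 hd).1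
    have heq : cyclotomic m ℚ = cyclotomic (d / d.gcd k) ℚ :=
      eq_of_monic_of_associated (cyclotomic.monic m ℚ) (cyclotomic.monic _ ℚ)
        ((cyclotomic.irreducible_rat hm).associated_of_dvd (cyclotomic.irreducible_rat (div_gcd_pos hd0 k)) hmm')
    exact ⟨d, (Finset.mem_filter.1 hd).1, (Finset.mem_filter.1 hd).2, (cyclotomic_injective heq).symm⟩
  · rintro ⟨d, hd, hdvd, rfl⟩
    exact cyclotomic_div_gcd_dvd_of_cyclotomic_dvd_expand (Nat.pos_of_mem_divisors hd) hk
      (hdvd.trans (minpoly_dvd_expand_minpoly_pow k))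

/-- **`q_{u^k} = Π_{m ∈ D_k} Φ_m`**, `D_k = {d/(d,k) : d ∣ n, Φ_d ∣ q_u}` (`uⁿ = 1` in any `ℚ`-algebra, `n, k > 0`).
[cite: AlvaradoAuffarth2018, §3 (eigenvalues of `fⁿ` are the `α_iⁿ`), p0006] [cite: LangeRodriguez2022, §6.1.1 Prop. 6.1.2, p0153] -/
theorem minpoly_pow_eq_prod_cyclotomic [DecidablePred fun d ↦ cyclotomic d ℚ ∣ minpoly ℚ u] (hn : 0 < n) (hu : u ^ n = 1) {k : ℕ} (hk : 0 < k) :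
    minpoly ℚ (u ^ k) = ∏ m ∈ (n.divisors.filter (fun d ↦ cyclotomic d ℚ ∣ minpoly ℚ u)).image
      (fun d ↦ d / d.gcd k), cyclotomic m ℚ := by
  classical
  have h := eq_prod_cyclotomic_of_dvd_X_pow_sub_one hn
    (minpoly.monic (isIntegral_of_pow_eq_one' hn (pow_pow_eq_one hu k))) (minpoly_dvd_X_pow_sub_one (pow_pow_eq_one hu k))
  conv_lhs => rw [h]
  refine Finset.prod_congr (Finset.ext fun m ↦ ?_) fun _ _ ↦ rfl
  rw [Finset.mem_filter, Finset.mem_image]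
  constructor
  · rintro ⟨hm, hdvd⟩
    obtain ⟨d, hd, hdq, rfl⟩ := (cyclotomic_dvd_minpoly_pow_iff hn hu hk (Nat.pos_of_mem_divisors hm)).1 hdvd
    exact ⟨d, Finset.mem_filter.2 ⟨hd, hdq⟩, rfl⟩
  · rintro ⟨d, hd, rfl⟩
    have hd' := Finset.mem_filter.1 hd
    have hd0 : 0 < d := Nat.pos_of_mem_divisors hd'.1
    refine ⟨Nat.mem_divisors.2 ⟨(div_gcd_dvd d k).trans (Nat.dvd_of_mem_divisors hd'.1), hn.ne'⟩, ?_⟩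
    exact (cyclotomic_dvd_minpoly_pow_iff hn hu hk (div_gcd_pos hd0 k)).2 ⟨d, hd'.1, hd'.2, rfl⟩

end Algebra

end CyclotomicIdempotents

/-! ### §2 Torus level: `D(u^k) = {d/(d,k)}`, coprime powers, the order `lcm D` -/

namespace ComplexTorus

open CyclotomicIdempotents

universe u

variable {ι : Type u} [Fintype ι] [DecidableEq ι] {E : Type*} [NormedAddCommGroup E] [NormedSpace ℂ E]
  {Φ : (ι → ℝ) ≃L[ℝ] E} {n : ℕ} {u : endAlgRat Φ}

section Powers

/-- `(u^k)ⁿ = 1` in `End_ℚ(X)`. [folklore] -/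
private theorem pow_pow_eq_one (hu : u ^ n = 1) (k : ℕ) : (u ^ k) ^ n = 1 := by
  rw [← pow_mul, mul_comm, pow_mul, hu, one_pow]

/-- `(uⁿ = 1)` on `H₁(X, ℚ)`. [folklore] -/
private theorem coe_pow_eq_one (hu : u ^ n = 1) : (u : Matrix ι ι ℚ) ^ n = 1 := by
  rw [← SubmonoidClass.coe_pow, hu, Subalgebra.coe_one]

/-- **`D(u^k) = {d/(d,k) : d ∈ D}`**: the eigenvalue orders of the power `u^k` (`uⁿ = 1`, `n, k > 0`) — «the orders
of the eigenvalues» of `u^k` are those of the `k`-th powers of the eigenvalues of `u`.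
[cite: CaroccaLangeRodriguez2019, §2.2 («`d_i | n` denote the orders of the eigenvalues»), p0004] [cite: AlvaradoAuffarth2018, §3, p0006] -/
theorem eigenvalueOrders_pow (hn : 0 < n) (hu : u ^ n = 1) {k : ℕ} (hk : 0 < k) :
    eigenvalueOrders n (u ^ k) = (eigenvalueOrders n u).image (fun d ↦ d / d.gcd k) := by
  classical
  ext m
  rw [mem_eigenvalueOrders_iff_cyclotomic_dvd_minpoly hn (pow_pow_eq_one hu k), SubmonoidClass.coe_pow,
    Finset.mem_image]
  constructor
  · rintro ⟨hm, hdvd⟩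
    obtain ⟨d, hd, hdq, rfl⟩ :=
      (cyclotomic_dvd_minpoly_pow_iff hn (coe_pow_eq_one hu) hk (Nat.pos_of_mem_divisors hm)).1 hdvd
    exact ⟨d, (mem_eigenvalueOrders_iff_cyclotomic_dvd_minpoly hn hu).2 ⟨hd, hdq⟩, rfl⟩
  · rintro ⟨d, hd, rfl⟩
    have hd' := (mem_eigenvalueOrders_iff_cyclotomic_dvd_minpoly hn hu).1 hd
    have hd0 : 0 < d := Nat.pos_of_mem_divisors hd'.1
    refine ⟨Nat.mem_divisors.2 ⟨(Nat.div_dvd_of_dvd (Nat.gcd_dvd_left d k)).trans (Nat.dvd_of_mem_divisors hd'.1),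
      hn.ne'⟩, ?_⟩
    exact (cyclotomic_dvd_minpoly_pow_iff hn (coe_pow_eq_one hu) hk
      (Nat.div_pos (Nat.gcd_le_left _ hd0) (Nat.gcd_pos_of_pos_left _ hd0))).2 ⟨d, hd'.1, hd'.2, rfl⟩

/-- **`q_{u^k} = Π_{m ∈ D_k} Φ_m`** on `H₁(X, ℚ)`. [cite: LangeRodriguez2022, §6.1.1 Prop. 6.1.2, p0153] [cite: AlvaradoAuffarth2018, §3, p0006] -/
theorem minpoly_coe_pow_eq_prod_cyclotomic (hn : 0 < n) (hu : u ^ n = 1) {k : ℕ} (hk : 0 < k) :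
    minpoly ℚ ((u : Matrix ι ι ℚ) ^ k) = ∏ m ∈ (eigenvalueOrders n u).image (fun d ↦ d / d.gcd k), cyclotomic m ℚ := by
  rw [← eigenvalueOrders_pow hn hu hk, ← SubmonoidClass.coe_pow,
    minpoly_coe_eq_prod_cyclotomic_eigenvalueOrders hn (pow_pow_eq_one hu k)]

/-- `deg q_{u^k} = Σ_{m ∈ D_k} φ(m)`. [cite: LangeRodriguez2022, §6.1.1, p0152–p0153] -/
theorem natDegree_minpoly_coe_pow (hn : 0 < n) (hu : u ^ n = 1) {k : ℕ} (hk : 0 < k) :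
    (minpoly ℚ ((u : Matrix ι ι ℚ) ^ k)).natDegree =
      ∑ m ∈ (eigenvalueOrders n u).image (fun d ↦ d / d.gcd k), Nat.totient m := by
  rw [minpoly_coe_pow_eq_prod_cyclotomic hn hu hk, natDegree_prod_cyclotomic]

/-- **`dim_ℚ ℚ[u^k] = Σ_{m ∈ D_k} φ(m)`** (`ℚ[u^k] ≅ Π_{m ∈ D_k} ℚ(ζ_m) ⊆ ℚ[u]`). [cite: LangeRodriguez2022, §6.1.1, p0152–p0153] -/
theorem finrank_adjoin_coe_pow (hn : 0 < n) (hu : u ^ n = 1) {k : ℕ} (hk : 0 < k) :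
    finrank ℚ (Algebra.adjoin ℚ {(u : Matrix ι ι ℚ) ^ k}) =
      ∑ m ∈ (eigenvalueOrders n u).image (fun d ↦ d / d.gcd k), Nat.totient m := by
  rw [← SubmonoidClass.coe_pow, finrank_adjoin_singleton_coe_eq_sum_totient hn (pow_pow_eq_one hu k),
    eigenvalueOrders_pow hn hu hk]

/-- **Remark 2.4: `φ(d) ≤ 2 dim X` for every eigenvalue order `d ∈ D`** (`Σ_{d ∈ D} φ(d) = deg q_u ≤ rk H₁(X, ℤ)`).
[cite: AlvaradoAuffarth2018, Remark 2.4, p0004] [cite: Lange2023AbelianVarietiesComplex, §2.4.5 Exercise (10)] -/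
theorem totient_le_card_of_mem_eigenvalueOrders (hn : 0 < n) (hu : u ^ n = 1) {d : ℕ} (hd : d ∈ eigenvalueOrders n u) :
    Nat.totient d ≤ Fintype.card ι :=
  (Finset.single_le_sum (fun _ _ ↦ Nat.zero_le _) hd).trans (sum_totient_eigenvalueOrders_le_card hn hu)

end Powers

/-! #### Coprime powers: `(k, n) = 1` -/

section Coprime

/-- **`D(u^k) = D` for `(k, n) = 1`** (`d ∣ n ⟹ (d, k) = 1`): Galois-conjugate powers have the same eigenvalue orders.
[cite: LangeRodriguez2022, §6.1.1 («`W_d := ⊕_{γ ∈ Gal(K_d/ℚ)} V_d^γ` is defined over the rationals»), p0152] -/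
theorem eigenvalueOrders_pow_of_coprime (hn : 0 < n) (hu : u ^ n = 1) {k : ℕ} (hk : 0 < k) (hkn : k.Coprime n) :
    eigenvalueOrders n (u ^ k) = eigenvalueOrders n u := by
  classical
  rw [eigenvalueOrders_pow hn hu hk]
  refine (Finset.image_congr fun d hd ↦ ?_).trans Finset.image_id
  have hdn : d ∣ n := Nat.dvd_of_mem_divisors ((mem_eigenvalueOrders_iff_cyclotomic_dvd_minpoly hn hu).1 hd).1
  have h1 : d.gcd k = 1 := Nat.Coprime.gcd_eq_one ((hkn.coprime_dvd_right hdn).symm)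
  rw [h1, Nat.div_one, id]

/-- **`q_{u^k} = q_u` for `(k, n) = 1`.** [cite: LangeRodriguez2022, §6.1.1, p0152–p0153] -/
theorem minpoly_coe_pow_of_coprime (hn : 0 < n) (hu : u ^ n = 1) {k : ℕ} (hk : 0 < k) (hkn : k.Coprime n) :
    minpoly ℚ ((u : Matrix ι ι ℚ) ^ k) = minpoly ℚ (u : Matrix ι ι ℚ) := by
  rw [← SubmonoidClass.coe_pow, minpoly_coe_eq_prod_cyclotomic_eigenvalueOrders hn (pow_pow_eq_one hu k),
    eigenvalueOrders_pow_of_coprime hn hu hk hkn, minpoly_coe_eq_prod_cyclotomic_eigenvalueOrders hn hu]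

/-- **`ℚ[u^k] = ℚ[u]` for `(k, n) = 1`** (`u` is a power of `u^k`). [cite: LangeRodriguez2022, §6.1.1, p0152] -/
theorem adjoin_coe_pow_eq_of_coprime (hu : u ^ n = 1) {k : ℕ} (hkn : k.Coprime n) :
    Algebra.adjoin ℚ {(u : Matrix ι ι ℚ) ^ k} = Algebra.adjoin ℚ {(u : Matrix ι ι ℚ)} := by
  refine le_antisymm (Algebra.adjoin_le (Set.singleton_subset_iff.2
    (Subalgebra.pow_mem _ (Algebra.self_mem_adjoin_singleton ℚ (u : Matrix ι ι ℚ)) k))) (Algebra.adjoin_le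
      (Set.singleton_subset_iff.2 ?_))
  have hord : k.Coprime (orderOf (u : Matrix ι ι ℚ)) :=
    hkn.coprime_dvd_right (orderOf_dvd_of_pow_eq_one (coe_pow_eq_one hu))
  obtain ⟨m, hm⟩ := exists_pow_eq_self_of_coprime hord
  have h := Subalgebra.pow_mem _ (Algebra.self_mem_adjoin_singleton ℚ ((u : Matrix ι ι ℚ) ^ k)) m
  rw [hm] at h
  exact h

/-- **`P^r_{u^k} = P^r_u` for `(k, n) = 1` and `P^r_u` squarefree** (`q_{u^k} = q_u = P^r_u` has full degree and
divides `P^r_{u^k}`). `-- TODO(general form)`: without the squarefree hypothesis (`P^r_{u^k}` has the roots `ζ^k`,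
a Galois permutation of those of `P^r_u`) — needs the tree's `Matrix.roots_charpoly_pow`, not imported here.
[cite: AlvaradoAuffarth2018, §3 («`F(n) = Δ_n(χ^r_f)`»), p0006] [cite: LangeRodriguez2022, §6.1.1 Prop. 6.1.2, p0153] -/
theorem charpoly_coe_pow_of_coprime (hn : 0 < n) (hu : u ^ n = 1) (hsq : Squarefree (u : Matrix ι ι ℚ).charpoly)
    {k : ℕ} (hk : 0 < k) (hkn : k.Coprime n) :
    ((u : Matrix ι ι ℚ) ^ k).charpoly = (u : Matrix ι ι ℚ).charpoly := by
  have hmin : minpoly ℚ ((u : Matrix ι ι ℚ) ^ k) = (u : Matrix ι ι ℚ).charpoly := by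
    rw [minpoly_coe_pow_of_coprime hn hu hk hkn, matrix_minpoly_eq_charpoly_of_squarefree_charpoly _ hsq]
  refine eq_of_monic_of_dvd_of_natDegree_le (Matrix.charpoly_monic _) (Matrix.charpoly_monic _) ?_ ?_
  · rw [← hmin]
    exact Matrix.minpoly_dvd_charpoly _
  · rw [Matrix.charpoly_natDegree_eq_dim, Matrix.charpoly_natDegree_eq_dim]

/-- `P^r_{u^k}` is squarefree for `(k, n) = 1` and `P^r_u` squarefree: every generator of `⟨u⟩` passes FILE 1's test
when one does. [cite: HornJohnson2013, §1.4 Def. 1.4.4 (p0112)] -/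
theorem squarefree_charpoly_coe_pow_of_coprime (hn : 0 < n) (hu : u ^ n = 1)
    (hsq : Squarefree (u : Matrix ι ι ℚ).charpoly) {k : ℕ} (hk : 0 < k) (hkn : k.Coprime n) :
    Squarefree ((u ^ k : endAlgRat Φ) : Matrix ι ι ℚ).charpoly := by
  rw [SubmonoidClass.coe_pow, charpoly_coe_pow_of_coprime hn hu hsq hk hkn]
  exact hsq

end Coprime

/-! #### The order of `u` is `lcm D` -/

section Order

/-- **`u^k = 1 ⟺ every eigenvalue order divides `k`** (`uⁿ = 1`, `n, k > 0`): `q_u = Π_{d ∈ D} Φ_d` divides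
`x^k − 1 = Π_{e ∣ k} Φ_e` iff `D ⊆ {e : e ∣ k}`. [cite: BambergCairnsKilminster2003, Thm. 1 (proof via Kuzmanovich–Pavlichenkov Thm. 2.7)]
[cite: CaroccaLangeRodriguez2019, §2.2, p0004] -/
theorem pow_eq_one_iff_forall_dvd (hn : 0 < n) (hu : u ^ n = 1) {k : ℕ} (hk : 0 < k) :
    u ^ k = 1 ↔ ∀ d ∈ eigenvalueOrders n u, d ∣ k := by
  constructor
  · intro huk d hd
    have hd' := (mem_eigenvalueOrders_iff_cyclotomic_dvd_minpoly hn hu).1 hd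
    have hd0 : 0 < d := Nat.pos_of_mem_divisors hd'.1
    have hdvd : cyclotomic d ℚ ∣ ∏ e ∈ k.divisors, cyclotomic e ℚ := by
      rw [prod_cyclotomic_eq_X_pow_sub_one hk]
      exact hd'.2.trans (minpoly.dvd ℚ _ (by simp [coe_pow_eq_one huk]))
    obtain ⟨e, he, hde⟩ := ((cyclotomic.irreducible_rat hd0).prime.dvd_finsetProd_iff _).1 hdvd
    have he0 : 0 < e := Nat.pos_of_mem_divisors he
    have heq : cyclotomic d ℚ = cyclotomic e ℚ :=
      eq_of_monic_of_associated (cyclotomic.monic d ℚ) (cyclotomic.monic e ℚ)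
        ((cyclotomic.irreducible_rat hd0).associated_of_dvd (cyclotomic.irreducible_rat he0) hde)
    rw [cyclotomic_injective heq]
    exact Nat.dvd_of_mem_divisors he
  · intro h
    have hdvd : minpoly ℚ (u : Matrix ι ι ℚ) ∣ X ^ k - 1 := by
      rw [minpoly_coe_eq_prod_cyclotomic_eigenvalueOrders hn hu, ← prod_cyclotomic_eq_X_pow_sub_one hk]
      exact Finset.prod_dvd_prod_of_subset _ _ _ fun d hd ↦ Nat.mem_divisors.2 ⟨h d hd, hk.ne'⟩
    have h0 : aeval (u : Matrix ι ι ℚ) (X ^ k - 1 : ℚ[X]) = 0 := minpoly.dvd_iff.1 hdvd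
    rw [map_sub, map_pow, aeval_X, map_one, sub_eq_zero] at h0
    exact Subtype.ext (by rw [SubmonoidClass.coe_pow, Subalgebra.coe_one]; exact h0)

/-- **The order of `u` is the least common multiple of its eigenvalue orders: `ord u = lcm D`.**
[cite: BambergCairnsKilminster2003, Thm. 1 (after Kuzmanovich–Pavlichenkov 2002 Thm. 2.7)] [cite: CaroccaLangeRodriguez2019, §2.2, p0004] -/
theorem orderOf_eq_lcm_eigenvalueOrders (hn : 0 < n) (hu : u ^ n = 1) : orderOf u = (eigenvalueOrders n u).lcm id := by
  have hpos : 0 < orderOf u := orderOf_pos_iff.2 (isOfFinOrder_iff_pow_eq_one.2 ⟨n, hn, hu⟩)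
  refine Nat.dvd_antisymm (orderOf_dvd_of_pow_eq_one ?_) (Finset.lcm_dvd fun d hd ↦ ?_)
  · rcases Nat.eq_zero_or_pos ((eigenvalueOrders n u).lcm id) with h0 | hl
    · rw [h0, pow_zero]
    · exact (pow_eq_one_iff_forall_dvd hn hu hl).2 fun d hd ↦ Finset.dvd_lcm hd
  · exact (pow_eq_one_iff_forall_dvd hn hu hpos).1 (pow_orderOf_eq_one u) d hd

/-- `ord u ∣ k ⟺ ∀ d ∈ D, d ∣ k`. [cite: BambergCairnsKilminster2003, Thm. 1] -/
theorem orderOf_dvd_iff_forall_dvd (hn : 0 < n) (hu : u ^ n = 1) (k : ℕ) :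
    orderOf u ∣ k ↔ ∀ d ∈ eigenvalueOrders n u, d ∣ k := by
  rw [orderOf_eq_lcm_eigenvalueOrders hn hu, Finset.lcm_dvd_iff]
  exact Iff.rfl

/-- **`1 ∈ D(u^k) ⟺ some `d ∈ D` divides `k`** (`u^k` has the eigenvalue `1` iff `ζ^k = 1` for some eigenvalue `ζ`
of `u`). [cite: AlvaradoAuffarth2018, Thm. 1.1 (3) («`#Fix(fⁿ) = 0` if `n ≡ 0 (mod n_i)`»), p0003] [cite: DolgachevZarhin2024, §2.2 (2.17), p0034] -/
theorem one_mem_eigenvalueOrders_pow_iff (hn : 0 < n) (hu : u ^ n = 1) {k : ℕ} (hk : 0 < k) :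
    1 ∈ eigenvalueOrders n (u ^ k) ↔ ∃ d ∈ eigenvalueOrders n u, d ∣ k := by
  classical
  rw [eigenvalueOrders_pow hn hu hk, Finset.mem_image]
  refine exists_congr fun d ↦ and_congr_right fun hd ↦ ?_
  have hd0 : 0 < d := Nat.pos_of_mem_divisors ((mem_eigenvalueOrders_iff_cyclotomic_dvd_minpoly hn hu).1 hd).1
  exact div_gcd_eq_one_iff hd0

end Order

/-! ### §3 Fixed points of the powers of an automorphism of finite order -/

section FixedPoints

variable {D : Matrix ι ι ℤ}

/-- `ρ_r(δ^k) ⊗ 1 = u^k`. [cite: Lange2023AbelianVarietiesComplex, §1.1.2 («`ρ_r(f'f) = ρ_r(f')ρ_r(f)`»), p. 20] -/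
theorem coe_pow_eq_map_pow (hD : (u : Matrix ι ι ℚ) = D.map (Int.cast : ℤ → ℚ)) (k : ℕ) :
    ((u ^ k : endAlgRat Φ) : Matrix ι ι ℚ) = (D ^ k).map (Int.cast : ℤ → ℚ) := by
  have h : (D ^ k).map (Int.castRingHom ℚ : ℤ → ℚ) = (D.map (Int.castRingHom ℚ : ℤ → ℚ)) ^ k := Matrix.map_pow _ _ _
  rw [Int.coe_castRingHom] at h
  rw [SubmonoidClass.coe_pow, hD, h]

/-- `uⁿ = 1 ⟹ Dⁿ = 1` for the integral matrix `D` with `D_ℚ = u`. [cite: Lange2023AbelianVarietiesComplex, §1.1.2 (`ρ_r` is faithful), p. 20] -/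
theorem pow_eq_one_of_coe_eq_map (hD : (u : Matrix ι ι ℚ) = D.map (Int.cast : ℤ → ℚ)) (hu : u ^ n = 1) : D ^ n = 1 := by
  apply Matrix.map_injective (f := (Int.castRingHom ℚ : ℤ → ℚ)) (Int.castRingHom ℚ).injective_int
  dsimp only
  rw [Matrix.map_one _ (map_zero _) (map_one _), Int.coe_castRingHom, ← coe_pow_eq_map_pow hD n, hu, Subalgebra.coe_one]

/-- **`#X^{δ^k} = 0` (i.e. `δ^k` has INFINITELY many fixed points) iff some eigenvalue order `d ∈ D` divides `k`**
(`#X^{δ^k} = |det(1 − ρ_r(δ)^k)| = |P^r_{u^k}(1)|` vanishes iff `Φ_1 ∣ P^r_{u^k}` iff `1 ∈ D(u^k)`): the zeros of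
Alvarado–Auffarth's fixed-point function of an automorphism of finite order lie exactly on `⋃_{d ∈ D} dℕ`.
[cite: AlvaradoAuffarth2018, Thm. 1.1 (2)–(3) and §3 («`F(n) = Δ_n(χ^r_f)`»), p0003, p0006] [cite: DolgachevZarhin2024, §2.2 (2.15)–(2.17), p0033–p0034] -/
theorem natCard_fixedSubgroup_pow_eq_zero_iff (hD : (u : Matrix ι ι ℚ) = D.map (Int.cast : ℤ → ℚ)) (hn : 0 < n)
    (hu : u ^ n = 1) {k : ℕ} (hk : 0 < k) :
    Nat.card (fixedSubgroup Φ (D ^ k)) = 0 ↔ ∃ d ∈ eigenvalueOrders n u, d ∣ k := by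
  rw [← one_mem_eigenvalueOrders_pow_iff hn hu hk,
    mem_eigenvalueOrders_iff_cyclotomic_dvd_charpoly hn (pow_pow_eq_one hu k), natCard_fixedSubgroup Φ (D ^ k),
    Int.natAbs_eq_zero, cyclotomic_one, ← C_1, dvd_iff_isRoot, IsRoot.def]
  have hdet : (((1 - D ^ k).det : ℤ) : ℚ) = ((u ^ k : endAlgRat Φ) : Matrix ι ι ℚ).charpoly.eval 1 :=
    intCast_det_one_sub_eq_eval_one (coe_pow_eq_map_pow hD k)
  rw [← hdet, Int.cast_eq_zero]
  exact ⟨fun h ↦ ⟨Nat.one_mem_divisors.2 hn.ne', h⟩, fun h ↦ h.2⟩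

/-- **`δ^k` has finitely many (`> 0`) fixed points iff NO eigenvalue order divides `k`.**
[cite: AlvaradoAuffarth2018, Thm. 1.1 (3), p0003] [cite: DolgachevZarhin2024, §2.2 (2.17) («`1` is not an eigenvalue»), p0034] -/
theorem natCard_fixedSubgroup_pow_pos_iff (hD : (u : Matrix ι ι ℚ) = D.map (Int.cast : ℤ → ℚ)) (hn : 0 < n)
    (hu : u ^ n = 1) {k : ℕ} (hk : 0 < k) :
    0 < Nat.card (fixedSubgroup Φ (D ^ k)) ↔ ∀ d ∈ eigenvalueOrders n u, ¬ d ∣ k := by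
  rw [pos_iff_ne_zero, Ne, natCard_fixedSubgroup_pow_eq_zero_iff hD hn hu hk]
  simp only [not_exists, not_and]

/-- `X^{δ^k}` is finite iff no eigenvalue order divides `k` (as `Nat.card`, `0` means infinite: the fixed group is
`Λ/(1 − ρ_r(δ^k))Λ`-counted). [cite: DolgachevZarhin2024, §2.2 (2.15), p0034] [cite: AlvaradoAuffarth2018, Thm. 1.1 (3), p0003] -/
theorem finite_fixedSubgroup_pow_iff (hD : (u : Matrix ι ι ℚ) = D.map (Int.cast : ℤ → ℚ)) (hn : 0 < n)
    (hu : u ^ n = 1) {k : ℕ} (hk : 0 < k) :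
    Finite (fixedSubgroup Φ (D ^ k)) ↔ ∀ d ∈ eigenvalueOrders n u, ¬ d ∣ k := by
  rw [← natCard_fixedSubgroup_pow_pos_iff hD hn hu hk]
  constructor
  · intro hfin
    exact Nat.card_pos
  · intro h
    exact Nat.finite_of_card_ne_zero h.ne'

/-- For `0 < k < d` for all `d ∈ D` (e.g. `k < min D`), `δ^k` has finitely many fixed points.
[cite: AlvaradoAuffarth2018, Thm. 1.1 (3) («`n_1, …, n_r ≥ 2`»), p0003] -/
theorem natCard_fixedSubgroup_pow_pos_of_forall_lt (hD : (u : Matrix ι ι ℚ) = D.map (Int.cast : ℤ → ℚ)) (hn : 0 < n)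
    (hu : u ^ n = 1) {k : ℕ} (hk : 0 < k) (hlt : ∀ d ∈ eigenvalueOrders n u, k < d) :
    0 < Nat.card (fixedSubgroup Φ (D ^ k)) :=
  (natCard_fixedSubgroup_pow_pos_iff hD hn hu hk).2 fun d hd hdk ↦ absurd (Nat.le_of_dvd hk hdk) (not_le.2 (hlt d hd))

omit [DecidableEq ι] in
/-- **PERIODICITY: `X^{δ^{k+n}} = X^{δ^k}`** for `δⁿ = 1` — the fixed-point function of an automorphism of finite
order is periodic. [cite: AlvaradoAuffarth2018, Thm. 1.1 (2) («It is a periodic function»), p0003] -/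
theorem fixedSubgroup_pow_add [DecidableEq ι] (hDn : D ^ n = 1) (k : ℕ) :
    fixedSubgroup Φ (D ^ (k + n)) = fixedSubgroup Φ (D ^ k) := by
  rw [pow_add, hDn, mul_one]

/-- **`#X^{δ^k} = #X^{δ^{k mod n}}`** for `δⁿ = 1`: the fixed-point function has period `n`.
[cite: AlvaradoAuffarth2018, Thm. 1.1 (2), p0003] [cite: BauerHerrig2016, §1] -/
theorem natCard_fixedSubgroup_pow_eq_mod (hDn : D ^ n = 1) (k : ℕ) :
    Nat.card (fixedSubgroup Φ (D ^ k)) = Nat.card (fixedSubgroup Φ (D ^ (k % n))) := by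
  conv_lhs => rw [← Nat.div_add_mod k n, pow_add, pow_mul, hDn, one_pow, one_mul]

/-- `δ^{ord}` fixes everything: `#X^{δⁿ} = #X = 0` (the torus is infinite) for `δⁿ = 1`, `X ≠ 0`.
[cite: AlvaradoAuffarth2018, Thm. 1.1 (3), p0003] -/
theorem natCard_fixedSubgroup_pow_self [Nonempty ι] (hDn : D ^ n = 1) : Nat.card (fixedSubgroup Φ (D ^ n)) = 0 := by
  rw [hDn, natCard_fixedSubgroup Φ (1 : Matrix ι ι ℤ), sub_self, Matrix.det_zero, Int.natAbs_zero]

variable [FiniteDimensional ℂ E]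

/-- **`(k, n) = 1`, `P^r_u` squarefree ⟹ `#X^{δ^k} = #X^δ`**: Galois-conjugate powers of a CM automorphism have the
same number of fixed points (`= P^r_u(1)`). [cite: AlvaradoAuffarth2018, §3 («`F(n) = Δ_n(χ^r_f)`»), p0006] [cite: DolgachevZarhin2024, §2.2 (2.15), p0034] -/
theorem natCard_fixedSubgroup_pow_of_coprime (hD : (u : Matrix ι ι ℚ) = D.map (Int.cast : ℤ → ℚ)) (hn : 0 < n)
    (hu : u ^ n = 1) (hsq : Squarefree (u : Matrix ι ι ℚ).charpoly) {k : ℕ} (hk : 0 < k) (hkn : k.Coprime n) :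
    Nat.card (fixedSubgroup Φ (D ^ k)) = Nat.card (fixedSubgroup Φ D) := by
  have hsq' := squarefree_charpoly_coe_pow_of_coprime hn hu hsq hk hkn
  have h₁ := natCard_fixedSubgroup_eq_eval_one (coe_pow_eq_map_pow hD k) hsq' (Φ := Φ)
  have h₂ := natCard_fixedSubgroup_eq_eval_one hD hsq (Φ := Φ)
  rw [SubmonoidClass.coe_pow, charpoly_coe_pow_of_coprime hn hu hsq hk hkn, ← h₂] at h₁
  exact_mod_cast h₁

end FixedPoints

/-! ### §4 Instances: `E_i` (`D = {4}`: `(2, 4, 2, 0, …)`), `E_i × E_ω` (`D = {4, 3}`: zeros on `4ℕ ∪ 3ℕ`) -/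

section Examples

/-- `R_i ⊗ 1 = gaussJ`. [folklore] -/
private theorem rotI_map_intCast_eq_gaussJ' : rotI.map (Int.cast : ℤ → ℚ) = gaussJ := by
  ext i j
  fin_cases i <;> fin_cases j <;> simp [rotI, gaussJ]

variable (hI : Complex.I.im ≠ 0)

/-- **`E_i`: the automorphism `i^k` has infinitely many fixed points iff `4 ∣ k`** (`D = {4}`).
[cite: AlvaradoAuffarth2018, Thm. 1.1 (3) (`n_1 = 4`), p0003] [cite: BauerHerrig2016, §1] -/
theorem natCard_fixedSubgroup_rotI_pow_eq_zero_iff {k : ℕ} (hk : 0 < k) :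
    Nat.card (fixedSubgroup (ellipticPeriod hI) (rotI ^ k)) = 0 ↔ 4 ∣ k := by
  rw [natCard_fixedSubgroup_pow_eq_zero_iff (Φ := ellipticPeriod hI) (u := ⟨gaussJ, gaussJ_mem_endAlgRat hI⟩)
    rotI_map_intCast_eq_gaussJ'.symm (by norm_num) (gaussEnd_pow_four hI) hk, eigenvalueOrders_gaussEnd]
  simp

/-- **`E_i`: `i^k` has exactly `2` fixed points for `k` odd** (`(k, 4) = 1`, `P^r = Φ₄` squarefree).
[cite: AlvaradoAuffarth2018, Thm. 1.1 (2), p0003] [cite: DolgachevZarhin2024, §2.2 (2.15), p0034] -/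
theorem natCard_fixedSubgroup_rotI_pow_of_odd {k : ℕ} (hk : Odd k) :
    Nat.card (fixedSubgroup (ellipticPeriod hI) (rotI ^ k)) = 2 := by
  have hk4 : k.Coprime 4 := by
    rw [show (4 : ℕ) = 2 ^ 2 from rfl]
    exact Nat.Coprime.pow_right 2 hk.coprime_two_right
  rw [natCard_fixedSubgroup_pow_of_coprime (Φ := ellipticPeriod hI) (u := ⟨gaussJ, gaussJ_mem_endAlgRat hI⟩)
    rotI_map_intCast_eq_gaussJ'.symm (by norm_num) (gaussEnd_pow_four hI) squarefree_charpoly_gaussJ hk.pos hk4,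
    natCard_fixedSubgroup_rotI]

/-- `R_i² = −1`. [folklore] -/
private theorem rotI_sq' : rotI ^ 2 = -1 := by
  ext i j
  fin_cases i <;> fin_cases j <;> simp [rotI, pow_two, Matrix.mul_apply, Fin.sum_univ_two]

/-- **`E_i`: `i² = −1` has exactly `4 = Φ₂(1)²` fixed points** (`X^{−1} = E_i[2]`; `P^r_{−1} = Φ₂²` is NOT
squarefree — p11's one-factor formula `#X^δ = Φ_ℓ(1)^{2g/(ℓ−1)}` applies): the fixed-point function of `i` is
`(2, 4, 2, 0, 2, 4, 2, 0, …)`. [cite: DolgachevZarhin2024, §2.2 (2.15) («`#A^δ = ℓ^{2dim A/(ℓ−1)}`», `ℓ = 2`), p0034]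
[cite: AlvaradoAuffarth2018, Thm. 1.1 (2), p0003] -/
theorem natCard_fixedSubgroup_rotI_sq : Nat.card (fixedSubgroup (ellipticPeriod hI) (rotI ^ 2)) = 4 := by
  have h := natCard_fixedSubgroup_eq_pow (Φ := ellipticPeriod hI) (D := rotI ^ 2) two_pos
    (by rw [cyclotomic_two, rotI_sq']; simp)
  rw [h, cyclotomic_two, Fintype.card_fin, Nat.totient_two]
  norm_num

/-- **`E_i × E_ω`: the automorphism `(i, ω)^k` (p38's `surfaceAutMatrix^k`) has infinitely many fixed points iff
`4 ∣ k` or `3 ∣ k`** (`D = {4, 3}`). [cite: AlvaradoAuffarth2018, Thm. 1.1 (3) (`{n_i} = {4, 3}`), p0003] -/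
theorem natCard_fixedSubgroup_surfaceAutMatrix_pow_eq_zero_iff {k : ℕ} (hk : 0 < k) :
    Nat.card (fixedSubgroup surfacePeriod (surfaceAutMatrix ^ k)) = 0 ↔ 4 ∣ k ∨ 3 ∣ k := by
  have hmap : ((⟨Matrix.fromBlocks gaussJ 0 0 (rotOmega.map (Int.cast : ℤ → ℚ)), gaussOmega_mem_endAlgRat I_im_ne_zero⟩ :
      endAlgRat surfacePeriod) : Matrix (Fin 2 ⊕ Fin 2) (Fin 2 ⊕ Fin 2) ℚ) = surfaceAutMatrix.map (Int.cast : ℤ → ℚ) := by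
    change Matrix.fromBlocks gaussJ 0 0 (rotOmega.map (Int.cast : ℤ → ℚ)) = _
    rw [surfaceAutMatrix, Matrix.fromBlocks_map, rotI_map_intCast_eq_gaussJ', Matrix.map_zero _ Int.cast_zero]
  have hD' : eigenvalueOrders 12 (⟨Matrix.fromBlocks gaussJ 0 0 (rotOmega.map (Int.cast : ℤ → ℚ)),
      gaussOmega_mem_endAlgRat I_im_ne_zero⟩ : endAlgRat surfacePeriod) = {4, 3} :=
    eigenvalueOrders_surfaceAut I_im_ne_zero
  rw [natCard_fixedSubgroup_pow_eq_zero_iff hmap (by norm_num) (gaussOmegaEnd_pow_twelve I_im_ne_zero) hk, hD']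
  simp

/-- **`E_i × E_ω`: `(i, ω)^k` has exactly `6` fixed points for `(k, 12) = 1`.** [cite: AlvaradoAuffarth2018, Thm. 1.1 (2), p0003]
[cite: DolgachevZarhin2024, §2.2 (2.15), p0034] -/
theorem natCard_fixedSubgroup_surfaceAutMatrix_pow_of_coprime {k : ℕ} (hk : 0 < k) (hk12 : k.Coprime 12) :
    Nat.card (fixedSubgroup surfacePeriod (surfaceAutMatrix ^ k)) = 6 := by
  have hmap : ((⟨Matrix.fromBlocks gaussJ 0 0 (rotOmega.map (Int.cast : ℤ → ℚ)), gaussOmega_mem_endAlgRat I_im_ne_zero⟩ :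
      endAlgRat surfacePeriod) : Matrix (Fin 2 ⊕ Fin 2) (Fin 2 ⊕ Fin 2) ℚ) = surfaceAutMatrix.map (Int.cast : ℤ → ℚ) := by
    change Matrix.fromBlocks gaussJ 0 0 (rotOmega.map (Int.cast : ℤ → ℚ)) = _
    rw [surfaceAutMatrix, Matrix.fromBlocks_map, rotI_map_intCast_eq_gaussJ', Matrix.map_zero _ Int.cast_zero]
  rw [natCard_fixedSubgroup_pow_of_coprime hmap (by norm_num) (gaussOmegaEnd_pow_twelve I_im_ne_zero)
    squarefree_charpoly_gaussOmega hk hk12, natCard_fixedSubgroup_surfaceAutMatrix]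

/-- **`E_i × E_ω`: `lcm D = lcm{4, 3} = 12`** — the order of `(i, ω)` read off the eigenvalue orders (p38's
`orderOf_surfaceAutMatrix = 12` on the integral matrix). [cite: BambergCairnsKilminster2003, Thm. 1 (`ψ(12) = φ(4) + φ(3) = 4`)]
[cite: CaroccaLangeRodriguez2019, §2.2, p0004] -/
theorem orderOf_gaussOmegaEnd :
    orderOf (⟨Matrix.fromBlocks gaussJ 0 0 (rotOmega.map (Int.cast : ℤ → ℚ)), gaussOmega_mem_endAlgRat hI⟩ :
      endAlgRat (prodPeriod (ellipticPeriod hI) (ellipticPeriod omega_im_ne_zero))) = 12 := by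
  rw [orderOf_eq_lcm_eigenvalueOrders (by norm_num) (gaussOmegaEnd_pow_twelve hI), eigenvalueOrders_surfaceAut hI]
  decide

end Examples

end ComplexTorus

end Literature.Geometry.Kaehler
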